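import Summits.Ventures.PercRepro.SixFourResidueFourGenericTail

/-!
# PercRepro — C-025 at `(6,4)`: the QUANTITATIVE per-pair margins at `t = 4` for `g ≥ 101` (mine-2 g22, §21.23; lead RULING (no))

For the plane-line branch (TW-∞, §21.18.7) the per-pair inequality of Theorem G is needed with a MARGIN: with `c = g − p`,
`T⁺(g,p) = C(p,2)·min_m L₄(g,p,m)/C(m,2) − base₄(g,p) ≥ a(c)·2^p` (no partner term).  Here: `perPair4_margin` (Regime I,
`3 ≤ c ≤ 10`, the exact table `aI`), `perPair4_margin_IIa` (`c ≥ 11`, `2c ≤ g`, `aIIa c`) and `perPair4_margin_IIb` (`c ≥ 11`,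
`2c > g`, `aIIb c`), each in the form `C(m,2)·(base₄ + a·2^p) ≤ C(p,2)·L₄` for every `2 ≤ m < p`.  The proofs are those of
`SixFourResidueFourGenericTail` with the sufficient condition (S₄) re-stated at `K₄ + a` (δ-term on `j ≤ 4`, price term from `j = 5`).
-/

namespace PercRepro.SixFour

/-- The Regime-I margin table `a(c)`, `3 ≤ c ≤ 10` (§21.23; `0` elsewhere). -/
def aI : ℕ → ℚ
  | 3 => 1226293 / 2500000
  | 4 => 1167553 / 1250000
  | 5 => 3756871 / 1875000
  | 6 => 36488849 / 8750000
  | 7 => 8287003 / 1000000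
  | 8 => 7156067 / 450000
  | 9 => 4661581 / 156250
  | 10 => 151883641 / 2750000
  | _ => 0

/-- The Regime-II margin for `2c ≤ g`: `(799/1000)·(99/202)²·2^c/(c+1) − (c − 2/5)`. -/
def aIIa (c : ℕ) : ℚ := 799 / 1000 * (99 / 202) ^ 2 * 2 ^ c / (c + 1) - ((c : ℚ) - 2 / 5)

/-- The Regime-II margin for `2c > g`: `(799/1000)·3·2^c/(c(2c−1)(c+1)) − (c − 2/5)`. -/
def aIIb (c : ℕ) : ℚ := 799 / 1000 * 3 * 2 ^ c / ((c : ℚ) * (2 * c - 1) * (c + 1)) - ((c : ℚ) - 2 / 5)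

/-- **The sufficient condition with a margin**: `(K₄ + a)·2^p ≤ t·y_P·C(p,2) + Q₄ ⇒ C(m,2)·(base₄ + a·2^p) ≤ C(p,2)·L₄`
(the chain of `perPair4_of_S` without the partner term). -/
theorem perPair4_of_S_margin {g p m : ℕ} (hmp : m < p) (hpg : p + 3 ≤ g) (a : ℚ)
    (hS : ((((g - p : ℕ) : ℚ) - 2 / 5) + a) * 2 ^ p ≤
      ((p - m : ℕ) : ℚ) / (((g - p : ℕ) : ℚ) + ((p - m : ℕ) : ℚ)) * (yP4 g * (p.choose 2 : ℚ))
        + tailQ4 ((g - p : ℕ) : ℚ) ((p - m : ℕ) : ℚ) m) :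
    (m.choose 2 : ℚ) * (base4 g p + a * 2 ^ p) ≤ (p.choose 2 : ℚ) * Lterm4 g p m := by
  rw [Lterm4_eq hmp.le (by omega) (by omega)]
  unfold base4
  rw [show ((g : ℚ) - p) = ((g - p : ℕ) : ℚ) by rw [Nat.cast_sub (by omega)]]
  unfold tailQ4 at hS
  set c : ℚ := ((g - p : ℕ) : ℚ) with hc_def
  set j : ℚ := ((p - m : ℕ) : ℚ) with hj_def
  set t : ℚ := j / (c + j) with ht_def
  have hc : (3 : ℚ) ≤ c := by rw [hc_def]; exact_mod_cast (by omega : 3 ≤ g - p)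
  have hj : (1 : ℚ) ≤ j := by rw [hj_def]; exact_mod_cast (by omega : 1 ≤ p - m)
  have ht0 : 0 ≤ t := by rw [ht_def]; positivity
  have ht1 : t ≤ 1 := by rw [ht_def, div_le_one (by linarith)]; linarith
  have hC2 : (0 : ℚ) ≤ (m.choose 2 : ℚ) := by positivity
  have hC2P2 : (m.choose 2 : ℚ) ≤ (p.choose 2 : ℚ) := by exact_mod_cast Nat.choose_le_choose 2 hmp.le
  have hP2 : (0 : ℚ) ≤ (p.choose 2 : ℚ) := by positivity
  have hDp : (delta p : ℚ) ≤ 2 ^ p := by exact_mod_cast delta_le_two_pow p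
  have hC4p : (0 : ℚ) ≤ (p.choose 4 : ℚ) := by positivity
  have hC4 : (0 : ℚ) ≤ (m.choose 4 : ℚ) := by positivity
  have hK : (0 : ℚ) ≤ c - 2 / 5 := by linarith
  have hQ : 0 ≤ (eps m : ℚ) * j * c / 3 + (delta m : ℚ) * ((c - 2 / 5) + 2 / 5 * t) + 8 / 5 * (m.choose 4 : ℚ) * (t - 1) := by
    have := tailQ4_nonneg hc hj m
    unfold tailQ4 at this
    exact this
  have h1 : (m.choose 2 : ℚ) * (((c - 2 / 5) * (delta p : ℚ) - 8 / 5 * (p.choose 4 : ℚ)) + a * 2 ^ p) ≤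
      (m.choose 2 : ℚ) * (((c - 2 / 5) + a) * 2 ^ p) := by
    apply mul_le_mul_of_nonneg_left _ hC2
    have := mul_le_mul_of_nonneg_left hDp hK
    nlinarith
  have h2 := mul_le_mul_of_nonneg_left hS hC2
  have h3 := mul_le_mul_of_nonneg_right hC2P2 hQ
  have hb : bonus m = 2 / 5 * (delta m : ℚ) + 8 / 5 * (m.choose 4 : ℚ) := rfl
  have h4 : 0 ≤ (p.choose 2 : ℚ) * (t * bonus m - (delta m : ℚ) * (2 / 5 * t) - 8 / 5 * (m.choose 4 : ℚ) * t) := by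
    apply mul_nonneg hP2
    rw [hb]
    nlinarith [ht0, ht1, hC4]
  linarith [h1, h2, h3, h4]

/-- A `δ`-term cell with the bonus term kept: if `A·2^p ≤ y_P·C(p,2)` (`2^p = 2^m·2^j`) and
`K·2^j ≤ t·A·2^j + (927/1000)·[jc/3 + (c − 2/5) + (2/5)t − 131/625]`, then `K·2^p ≤ t·y_P·C(p,2) + Q₄` (`m ≥ 12`). -/
theorem S_of_delta_cell4' {c j m : ℕ} (hm12 : 12 ≤ m) {A YP K : ℚ} (hX : A * (2 ^ m * 2 ^ j) ≤ YP)
    (hbr : 0 ≤ ((j : ℚ) * c / 3 + ((c : ℚ) - 2 / 5) + 2 / 5 * ((j : ℚ) / (c + j)) - 131 / 625))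
    (hnum : K * 2 ^ j ≤ (j : ℚ) / (c + j) * A * 2 ^ j +
      927 / 1000 * ((j : ℚ) * c / 3 + ((c : ℚ) - 2 / 5) + 2 / 5 * ((j : ℚ) / (c + j)) - 131 / 625)) :
    K * (2 ^ m * 2 ^ j) ≤ (j : ℚ) / (c + j) * YP + tailQ4 c j m := by
  obtain ⟨hD, hC4, hE⟩ := delta_bounds hm12
  have hDnn : (0 : ℚ) ≤ (delta m : ℚ) := by positivity
  have h2m : (0 : ℚ) ≤ 2 ^ m := by positivity
  have hjc : (0 : ℚ) ≤ (j : ℚ) * c / 3 := by positivity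
  have ht : (0 : ℚ) ≤ (j : ℚ) / (c + j) := by positivity
  have hC4n : (0 : ℚ) ≤ (m.choose 4 : ℚ) := by positivity
  have hQ1 : (delta m : ℚ) * ((j : ℚ) * c / 3 + ((c : ℚ) - 2 / 5) + 2 / 5 * ((j : ℚ) / (c + j)) - 131 / 625) ≤ tailQ4 c j m := by
    unfold tailQ4
    have h1 : (delta m : ℚ) * ((j : ℚ) * c / 3) ≤ (eps m : ℚ) * j * c / 3 := by
      have := mul_le_mul_of_nonneg_right hE hjc; linarith
    have h2 : (8 / 5 : ℚ) * (m.choose 4 : ℚ) * ((j : ℚ) / (c + j) - 1) ≥ -(131 / 625) * (delta m : ℚ) := by nlinarith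
    nlinarith
  have hQ2 : (927 / 1000 : ℚ) * 2 ^ m * ((j : ℚ) * c / 3 + ((c : ℚ) - 2 / 5) + 2 / 5 * ((j : ℚ) / (c + j)) - 131 / 625) ≤
      (delta m : ℚ) * ((j : ℚ) * c / 3 + ((c : ℚ) - 2 / 5) + 2 / 5 * ((j : ℚ) / (c + j)) - 131 / 625) :=
    mul_le_mul_of_nonneg_right hD hbr
  have hnum' := mul_le_mul_of_nonneg_right hnum h2m
  have hX' : (j : ℚ) / (c + j) * A * 2 ^ j * 2 ^ m ≤ (j : ℚ) / (c + j) * YP := by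
    have := mul_le_mul_of_nonneg_left hX ht
    nlinarith
  nlinarith

/-- **Regime I with the margin** (§21.23, Theorem 21.23 (I)): for `g ≥ 101`, `3 ≤ c = g − p ≤ 10`, `2 ≤ m < p`,
`C(m,2)·(base₄ g p + a(c)·2^p) ≤ C(p,2)·L₄ g p m` — i.e. `T⁺(g,p) ≥ a(c)·2^p`. -/
theorem perPair4_margin {g p m : ℕ} (hg : 101 ≤ g) (hpg : p + 3 ≤ g) (hgp : g ≤ p + 10) (hm : 2 ≤ m) (hmp : m < p) :
    (m.choose 2 : ℚ) * (base4 g p + aI (g - p) * 2 ^ p) ≤ (p.choose 2 : ℚ) * Lterm4 g p m := by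
  apply perPair4_of_S_margin hmp hpg
  obtain ⟨c, hc⟩ : ∃ c, c = g - p := ⟨_, rfl⟩
  obtain ⟨j, hj⟩ : ∃ j, j = p - m := ⟨_, rfl⟩
  rw [← hc, ← hj]
  have hc3 : 3 ≤ c := by omega
  have hc10 : c ≤ 10 := by omega
  have hj1 : 1 ≤ j := by omega
  have hp91 : 91 ≤ p := by omega
  have hcq3 : (3 : ℚ) ≤ c := by exact_mod_cast hc3
  have hjq1 : (1 : ℚ) ≤ j := by exact_mod_cast hj1
  have hQ := tailQ4_nonneg (c := c) (j := j) (by linarith) hjq1 m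
  have hP2 : (0 : ℚ) ≤ (p.choose 2 : ℚ) := by positivity
  have hG2 : (0 : ℚ) < (g.choose 2 : ℚ) := by exact_mod_cast Nat.choose_pos (by omega : 2 ≤ g)
  have hY : (799 / 1000 : ℚ) * 2 ^ g ≤ Fg g := Fg_ge hg
  have hρ := rho_regI hg hc hc10 hpg
  have hpow : (2 : ℚ) ^ g = 2 ^ c * 2 ^ p := by rw [← pow_add]; congr 1; omega
  have h2p : (0 : ℚ) < 2 ^ p := by positivity
  have h2c : (0 : ℚ) < 2 ^ c := by positivity
  have hX : (799 / 1000 : ℚ) * (((99 : ℚ) - c) / 100) ^ 2 * 2 ^ c * 2 ^ p ≤ yP4 g * (p.choose 2 : ℚ) := by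
    have e : yP4 g * (p.choose 2 : ℚ) = Fg g * (p.choose 2 : ℚ) / (g.choose 2 : ℚ) := by unfold yP4; ring
    rw [e, le_div_iff₀ hG2]
    have h1 := mul_le_mul_of_nonneg_right hY hP2
    rw [hpow] at h1
    have h2 := mul_le_mul_of_nonneg_left hρ (by positivity : (0 : ℚ) ≤ (799 / 1000) * 2 ^ c * 2 ^ p)
    have h3 : (0 : ℚ) ≤ (((99 : ℚ) - c) / 100) ^ 2 := by positivity
    nlinarith
  have hYP : 0 ≤ yP4 g * (p.choose 2 : ℚ) := by
    have h3 : (0 : ℚ) ≤ (799 / 1000 : ℚ) * (((99 : ℚ) - c) / 100) ^ 2 * 2 ^ c * 2 ^ p := by positivity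
    linarith
  have hpm : (2 : ℚ) ^ p = 2 ^ m * 2 ^ j := by rw [← pow_add]; congr 1; omega
  rcases Nat.lt_or_ge j 5 with hj5 | hj5
  · -- `j ≤ 4`: the `δ`-cells (`m = p − j ≥ 87`)
    rw [hpm] at hX ⊢
    interval_cases c <;> interval_cases j <;> exact S_of_delta_cell4' (by omega) hX (by norm_num [aI]) (by norm_num [aI])
  · -- `j ≥ 5`: the price term alone
    have hjq : (5 : ℚ) ≤ j := by exact_mod_cast hj5
    interval_cases c <;> exact S_of_yterm (5 : ℚ) (by norm_num) (by norm_num) hjq hX (by norm_num [aI]) hQ h2p.le hYP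

/-- **Regime II-a with the margin** (§21.23 (II), `2c ≤ g`): for `g ≥ 101`, `c = g − p ≥ 11` with `2c ≤ g`, `3 ≤ p`, `m < p`,
`C(m,2)·(base₄ g p + aIIa c·2^p) ≤ C(p,2)·L₄ g p m`. -/
theorem perPair4_margin_IIa {g p m : ℕ} (hg : 101 ≤ g) (hp : 3 ≤ p) (hpg : p + 11 ≤ g) (h2c : 2 * (g - p) ≤ g)
    (hmp : m < p) : (m.choose 2 : ℚ) * (base4 g p + aIIa (g - p) * 2 ^ p) ≤ (p.choose 2 : ℚ) * Lterm4 g p m := by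
  apply perPair4_of_S_margin hmp (by omega)
  obtain ⟨c, hc⟩ : ∃ c, c = g - p := ⟨_, rfl⟩
  rw [← hc]
  set j : ℚ := ((p - m : ℕ) : ℚ) with hj_def
  have hc11 : 11 ≤ c := by omega
  have hcq : (11 : ℚ) ≤ c := by exact_mod_cast hc11
  have hj : (1 : ℚ) ≤ j := by rw [hj_def]; exact_mod_cast (by omega : 1 ≤ p - m)
  have hQ := tailQ4_nonneg (c := (c : ℚ)) (by linarith) hj m
  have hP2 : (0 : ℚ) ≤ (p.choose 2 : ℚ) := by positivity
  have hG2 : (0 : ℚ) < (g.choose 2 : ℚ) := by exact_mod_cast Nat.choose_pos (by omega : 2 ≤ g)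
  have hY : (799 / 1000 : ℚ) * 2 ^ g ≤ Fg g := Fg_ge hg
  have hpow : (2 : ℚ) ^ g = 2 ^ c * 2 ^ p := by rw [← pow_add]; congr 1; omega
  have h2p : (0 : ℚ) < 2 ^ p := by positivity
  have h2c' : (0 : ℚ) < 2 ^ c := by positivity
  -- `ρ ≥ (99/202)²`: `9801·C(g,2) ≤ 40804·C(p,2)`
  have hρ : (9801 : ℚ) * (g.choose 2 : ℚ) ≤ 40804 * (p.choose 2 : ℚ) := by
    rw [Nat.cast_choose_two ℚ g, Nat.cast_choose_two ℚ p]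
    have h0 : 99 * g ≤ 202 * (p - 1) := by omega
    have h0q : (99 : ℚ) * g ≤ 202 * ((p : ℚ) - 1) := by
      have : ((99 * g : ℕ) : ℚ) ≤ ((202 * (p - 1) : ℕ) : ℚ) := by exact_mod_cast h0
      push_cast [Nat.cast_sub (by omega : 1 ≤ p)] at this
      linarith
    have hgq : (101 : ℚ) ≤ g := by exact_mod_cast hg
    have hpq : (3 : ℚ) ≤ p := by exact_mod_cast hp
    nlinarith
  -- the price term: `(799/1000)(99/202)²·2^c·2^p ≤ y_P·C(p,2)`
  have hX : (799 / 1000 : ℚ) * (99 / 202) ^ 2 * 2 ^ c * 2 ^ p ≤ yP4 g * (p.choose 2 : ℚ) := by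
    have e : yP4 g * (p.choose 2 : ℚ) = Fg g * (p.choose 2 : ℚ) / (g.choose 2 : ℚ) := by unfold yP4; ring
    rw [e, le_div_iff₀ hG2]
    have h1 := mul_le_mul_of_nonneg_right hY hP2
    rw [hpow] at h1
    have h2 := mul_le_mul_of_nonneg_left hρ (by positivity : (0 : ℚ) ≤ (799 / 1000) * 2 ^ c * 2 ^ p / 40804)
    nlinarith
  have hYP : 0 ≤ yP4 g * (p.choose 2 : ℚ) := le_trans (by positivity) hX
  have hK : (((c : ℚ) - 2 / 5) + aIIa c) = 799 / 1000 * (99 / 202) ^ 2 * 2 ^ c / (c + 1) := by unfold aIIa; ring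
  rw [hK]
  have ht : 1 / ((c : ℚ) + 1) ≤ j / (c + j) := by
    rw [div_le_div_iff₀ (by linarith) (by linarith)]; nlinarith
  calc 799 / 1000 * (99 / 202 : ℚ) ^ 2 * 2 ^ c / (c + 1) * 2 ^ p
      = 1 / ((c : ℚ) + 1) * (799 / 1000 * (99 / 202) ^ 2 * 2 ^ c * 2 ^ p) := by ring
    _ ≤ 1 / ((c : ℚ) + 1) * (yP4 g * (p.choose 2 : ℚ)) := mul_le_mul_of_nonneg_left hX (by positivity)
    _ ≤ j / (c + j) * (yP4 g * (p.choose 2 : ℚ)) := mul_le_mul_of_nonneg_right ht hYP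
    _ ≤ j / (c + j) * (yP4 g * (p.choose 2 : ℚ)) + tailQ4 c j m := by linarith

/-- **Regime II-b with the margin** (§21.23 (II), `2c > g`): for `g ≥ 101`, `c = g − p ≥ 11` with `g < 2c`, `3 ≤ p`, `m < p`,
`C(m,2)·(base₄ g p + aIIb c·2^p) ≤ C(p,2)·L₄ g p m`. -/
theorem perPair4_margin_IIb {g p m : ℕ} (hg : 101 ≤ g) (hp : 3 ≤ p) (hpg : p + 11 ≤ g) (h2c : g < 2 * (g - p))
    (hmp : m < p) : (m.choose 2 : ℚ) * (base4 g p + aIIb (g - p) * 2 ^ p) ≤ (p.choose 2 : ℚ) * Lterm4 g p m := by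
  apply perPair4_of_S_margin hmp (by omega)
  obtain ⟨c, hc⟩ : ∃ c, c = g - p := ⟨_, rfl⟩
  rw [← hc]
  set j : ℚ := ((p - m : ℕ) : ℚ) with hj_def
  have hc11 : 11 ≤ c := by omega
  have hcq : (11 : ℚ) ≤ c := by exact_mod_cast hc11
  have hj : (1 : ℚ) ≤ j := by rw [hj_def]; exact_mod_cast (by omega : 1 ≤ p - m)
  have hQ := tailQ4_nonneg (c := (c : ℚ)) (by linarith) hj m
  have hP2 : (0 : ℚ) ≤ (p.choose 2 : ℚ) := by positivity
  have hG2 : (0 : ℚ) < (g.choose 2 : ℚ) := by exact_mod_cast Nat.choose_pos (by omega : 2 ≤ g)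
  have hY : (799 / 1000 : ℚ) * 2 ^ g ≤ Fg g := Fg_ge hg
  have hpow : (2 : ℚ) ^ g = 2 ^ c * 2 ^ p := by rw [← pow_add]; congr 1; omega
  have h2p : (0 : ℚ) < 2 ^ p := by positivity
  have h2c' : (0 : ℚ) < 2 ^ c := by positivity
  -- `C(p,2) ≥ 3` and `C(g,2) ≤ c(2c − 1)`
  have hP3 : (3 : ℚ) ≤ (p.choose 2 : ℚ) := by exact_mod_cast Nat.choose_le_choose 2 hp
  have hGc : (g.choose 2 : ℚ) ≤ (c : ℚ) * (2 * c - 1) := by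
    rw [Nat.cast_choose_two ℚ g]
    have hg2c : (g : ℚ) ≤ 2 * c - 1 := by
      have : g + 1 ≤ 2 * c := by omega
      have : ((g + 1 : ℕ) : ℚ) ≤ ((2 * c : ℕ) : ℚ) := by exact_mod_cast this
      push_cast at this; linarith
    have hgq : (101 : ℚ) ≤ g := by exact_mod_cast hg
    nlinarith
  have hcc : (0 : ℚ) < (c : ℚ) * (2 * c - 1) := by
    have : (0 : ℚ) < 2 * c - 1 := by linarith
    positivity
  have hden : (0 : ℚ) < (c : ℚ) * (2 * c - 1) * (c + 1) := by positivity
  -- the price term: `(799/1000)·3·2^c·2^p/(c(2c−1)) ≤ y_P·C(p,2)`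
  have hX : (799 / 1000 : ℚ) * 3 * 2 ^ c * 2 ^ p / ((c : ℚ) * (2 * c - 1)) ≤ yP4 g * (p.choose 2 : ℚ) := by
    have e : yP4 g * (p.choose 2 : ℚ) = Fg g * (p.choose 2 : ℚ) / (g.choose 2 : ℚ) := by unfold yP4; ring
    rw [e, div_le_div_iff₀ hcc hG2]
    have h1 := mul_le_mul_of_nonneg_right hY hP2
    rw [hpow] at h1
    set X : ℚ := 799 / 1000 * 2 ^ c * 2 ^ p with hX_def
    have hX0 : 0 ≤ X := by rw [hX_def]; positivity
    have s1 : 3 * X * (g.choose 2 : ℚ) ≤ 3 * X * ((c : ℚ) * (2 * c - 1)) := mul_le_mul_of_nonneg_left hGc (by positivity)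
    have s2 : 3 * X * ((c : ℚ) * (2 * c - 1)) ≤ X * (p.choose 2 : ℚ) * ((c : ℚ) * (2 * c - 1)) := by
      have := mul_le_mul_of_nonneg_left hP3 hX0
      exact mul_le_mul_of_nonneg_right (by linarith) hcc.le
    have h1' : X * (p.choose 2 : ℚ) ≤ Fg g * (p.choose 2 : ℚ) := by rw [hX_def]; linarith [h1]
    have s3 : X * (p.choose 2 : ℚ) * ((c : ℚ) * (2 * c - 1)) ≤ Fg g * (p.choose 2 : ℚ) * ((c : ℚ) * (2 * c - 1)) :=
      mul_le_mul_of_nonneg_right h1' hcc.le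
    nlinarith [s1, s2, s3]
  have hYP : 0 ≤ yP4 g * (p.choose 2 : ℚ) := le_trans (div_nonneg (by positivity) hcc.le) hX
  have hK : (((c : ℚ) - 2 / 5) + aIIb c) = 799 / 1000 * 3 * 2 ^ c / ((c : ℚ) * (2 * c - 1) * (c + 1)) := by unfold aIIb; ring
  rw [hK]
  have ht : 1 / ((c : ℚ) + 1) ≤ j / (c + j) := by
    rw [div_le_div_iff₀ (by linarith) (by linarith)]; nlinarith
  have e2 : (799 / 1000 : ℚ) * 3 * 2 ^ c / ((c : ℚ) * (2 * c - 1) * (c + 1)) * 2 ^ p =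
      1 / ((c : ℚ) + 1) * (799 / 1000 * 3 * 2 ^ c * 2 ^ p / ((c : ℚ) * (2 * c - 1))) := by
    field_simp
  calc 799 / 1000 * 3 * (2 : ℚ) ^ c / ((c : ℚ) * (2 * c - 1) * (c + 1)) * 2 ^ p
      = 1 / ((c : ℚ) + 1) * (799 / 1000 * 3 * 2 ^ c * 2 ^ p / ((c : ℚ) * (2 * c - 1))) := e2
    _ ≤ 1 / ((c : ℚ) + 1) * (yP4 g * (p.choose 2 : ℚ)) := mul_le_mul_of_nonneg_left hX (by positivity)
    _ ≤ j / (c + j) * (yP4 g * (p.choose 2 : ℚ)) := mul_le_mul_of_nonneg_right ht hYP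
    _ ≤ j / (c + j) * (yP4 g * (p.choose 2 : ℚ)) + tailQ4 c j m := by linarith

end PercRepro.SixFour
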